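import Literature.Analysis.Convex.SchauderFixedPoint
import HarnessLib

/-!
# Crux `PercShatteringRace.NearLinearTwoClusterDecay` (stmt-CriticalPhenomena-5785) — frontier stub V3a `stub_vdbdCubeSurj`

Helper file of the line `pair-decay-long-arms-dense`; lands with `--supports stmt-CriticalPhenomena-5785`
(registered stub `stub_vdbdCubeSurj`, § V of the skeleton: van den Berg–Don's topological step).

## Statement

`stub_vdbdCubeSurj` (**Poincaré–Miranda surjectivity of the cube**; van den Berg–Don 2020, Lemma 18,
proof due to L. Schrijver): let `f : [0,1]^d → ℝ^d` be continuous on the closed unit cube, with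
`f(x)_i ≤ lo_i` on the face `{x_i = 0}` and `hi_i ≤ f(x)_i` on the face `{x_i = 1}` for every `i`.
Then every `a` with `lo ≤ a ≤ hi` (pointwise) is a value of `f` on the cube. The lead's covering lemma
uses it with `d = 3`, `lo = 0`, `hi = n`.

## Proof

Brouwer's fixed point theorem for compact convex sets, IN TREE
(`Literature.Analysis.Convex.exists_fixedPoint_of_isCompact_convex`, file
`Literature/Analysis/Convex/SchauderFixedPoint`), applied in the sup-normed space `X = Fin d → ℝ` to
the compact convex cube `K = Set.Icc 0 1` (finite-dimensional ambient space, `E = ⊤`) and Schrijver's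
clamped map `T x = (max 0 (min 1 (x_i − (f(x)_i − a_i))))_i`, a continuous self-map of `K`. At a fixed
point `x ∈ K`, coordinatewise (`eq_zero_of_clamp_sub_eq`): if `0 < x_i < 1` the clamps are inactive and
`f(x)_i = a_i`; if `x_i = 0` the clamp forces `f(x)_i ≥ a_i ≥ lo_i ≥ f(x)_i`; if `x_i = 1` it forces
`f(x)_i ≤ a_i ≤ hi_i ≤ f(x)_i`. Hence `f x = a`.

## Mathlib / tree search

Mathlib v4.32.0 has no Poincaré–Miranda theorem and no Brouwer theorem (`lean search 'Miranda'`,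
`'Brouwer'`: tree only). Used: the tree's `exists_fixedPoint_of_isCompact_convex`; Mathlib's
`isCompact_Icc` (pi instance of `CompactIccSpace`), `convex_Icc`, `continuousOn_pi`,
`ContinuousOn.sup/inf/sub`, `Submodule.mem_top`, `FiniteDimensional.finiteDimensional_submodule`.

## References

* J. van den Berg, H. Don, *A lower bound for point-to-point connection probabilities in critical
  percolation*, Electron. Commun. Probab. 25 (2020), paper no. 47, Lemma 18 (proof by L. Schrijver)
  (arXiv:1912.10964) [VandenbergDon2020].
* W. Kulpa, *The Poincaré–Miranda theorem*, Amer. Math. Monthly 104 (1997) 545–550.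
* C. Miranda, *Un'osservazione su un teorema di Brouwer*, Boll. Un. Mat. Ital. (2) 3 (1940) 5–7.
-/

noncomputable section

namespace Summit.CriticalPhenomena.PercolationContinuityZ3.Theorems

namespace NearLinearTwoClusterDecayVdbdCubeSurj

open Set

/-- **Schrijver's clamped map** `T x = (max 0 (min 1 (x_i − (f(x)_i − a_i))))_i` on `ℝ^d` (whose fixed
points in the unit cube are the solutions of `f x = a`; van den Berg–Don 2020, proof of Lemma 18)
takes values in the unit cube `[0,1]^d`. [folklore] -/
theorem clampMap_mem_Icc {d : ℕ} (f : (Fin d → ℝ) → (Fin d → ℝ)) (a x : Fin d → ℝ) :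
    (fun i => max 0 (min 1 (x i - (f x i - a i)))) ∈ Icc (0 : Fin d → ℝ) 1 :=
  ⟨fun _ => le_max_left _ _, fun _ => max_le zero_le_one (min_le_left _ _)⟩

/-- The clamped map is continuous wherever `f` is. [folklore] -/
theorem continuousOn_clampMap {d : ℕ} {f : (Fin d → ℝ) → (Fin d → ℝ)} {K : Set (Fin d → ℝ)}
    (hf : ContinuousOn f K) (a : Fin d → ℝ) :
    ContinuousOn (fun x : Fin d → ℝ => fun i => max 0 (min 1 (x i - (f x i - a i)))) K := by
  refine continuousOn_pi.2 fun i => ?_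
  have h1 : ContinuousOn (fun x : Fin d → ℝ => x i - (f x i - a i)) K :=
    (continuous_apply i).continuousOn.sub ((continuousOn_pi.1 hf i).sub continuousOn_const)
  exact continuousOn_const.sup (continuousOn_const.inf h1)

/-- **The one-dimensional fixed-point bookkeeping**: if `max 0 (min 1 (x − e)) = x`, and `e ≤ 0`
whenever `x = 0`, and `0 ≤ e` whenever `x = 1`, then `e = 0` (if `0 < x < 1` the clamps are inactive;
on the faces the clamp gives the reverse inequality). [folklore] -/
theorem eq_zero_of_clamp_sub_eq {x e : ℝ} (h : max 0 (min 1 (x - e)) = x) (h0 : x = 0 → e ≤ 0)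
    (h1 : x = 1 → 0 ≤ e) : e = 0 := by
  rcases le_total (min 1 (x - e)) 0 with hle | hge
  · rw [max_eq_left hle] at h
    have hx : x = 0 := h.symm
    have he : e ≤ 0 := h0 hx
    rw [hx, zero_sub] at hle
    rcases min_le_iff.1 hle with h' | h'
    · exact absurd h' (not_le.2 one_pos)
    · linarith
  · rw [max_eq_right hge] at h
    rcases le_total 1 (x - e) with h1le | h1ge
    · rw [min_eq_left h1le] at h
      have hx : x = 1 := h.symm
      have he : 0 ≤ e := h1 hx
      rw [hx] at h1le
      linarith
    · rw [min_eq_right h1ge] at h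
      linarith

/-- **Poincaré–Miranda surjectivity of the cube, from Brouwer** (van den Berg–Don 2020, Lemma 18,
Schrijver's proof): with the face conditions `x_i = 0 ⟹ f(x)_i ≤ lo_i`, `x_i = 1 ⟹ hi_i ≤ f(x)_i`,
every `a ∈ [lo, hi]` is attained by `f` on `[0,1]^d` — a fixed point of Schrijver's clamped map on the
compact convex cube (tree's `exists_fixedPoint_of_isCompact_convex`) solves `f x = a`.
[cite: VandenbergDon2020, Lemma 18] -/
theorem exists_mem_Icc_apply_eq {d : ℕ} {f : (Fin d → ℝ) → (Fin d → ℝ)} {lo hi : Fin d → ℝ}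
    (hf : ContinuousOn f (Icc 0 1))
    (hlo : ∀ x ∈ Icc (0 : Fin d → ℝ) 1, ∀ i, x i = 0 → f x i ≤ lo i)
    (hhi : ∀ x ∈ Icc (0 : Fin d → ℝ) 1, ∀ i, x i = 1 → hi i ≤ f x i)
    {a : Fin d → ℝ} (hloa : lo ≤ a) (hahi : a ≤ hi) :
    ∃ x ∈ Icc (0 : Fin d → ℝ) 1, f x = a := by
  have hKc : IsCompact (Icc (0 : Fin d → ℝ) 1) := isCompact_Icc
  have hKconv : Convex ℝ (Icc (0 : Fin d → ℝ) 1) := convex_Icc 0 1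
  have hKne : (Icc (0 : Fin d → ℝ) 1).Nonempty := ⟨0, left_mem_Icc.2 zero_le_one⟩
  have hKE : Icc (0 : Fin d → ℝ) 1 ⊆ ((⊤ : Submodule ℝ (Fin d → ℝ)) : Set (Fin d → ℝ)) :=
    fun _ _ => Submodule.mem_top
  have hmaps : MapsTo (fun x : Fin d → ℝ => fun i => max 0 (min 1 (x i - (f x i - a i))))
      (Icc 0 1) (Icc 0 1) := fun x _ => clampMap_mem_Icc f a x
  obtain ⟨x, hxK, hx⟩ :=
    Literature.Analysis.Convex.exists_fixedPoint_of_isCompact_convex hKc hKconv hKne ⊤ hKE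
      (continuousOn_clampMap hf a) hmaps
  refine ⟨x, hxK, funext fun i => ?_⟩
  have hxi : max 0 (min 1 (x i - (f x i - a i))) = x i := congr_fun hx i
  have key : f x i - a i = 0 :=
    eq_zero_of_clamp_sub_eq hxi
      (fun h0 => by linarith [hlo x hxK i h0, hloa i])
      (fun h1 => by linarith [hhi x hxK i h1, hahi i])
  linarith

end NearLinearTwoClusterDecayVdbdCubeSurj

/-- **Frontier stub V3a (`vdbdCubeSurj`) — van den Berg–Don 2020 Lemma 18 (Poincaré–Miranda
surjectivity of the cube, proof by L. Schrijver from Brouwer's fixed point theorem).** A continuous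
`f : [0,1]^d → ℝ^d` with `f(x)_i ≤ lo_i` on `{x_i = 0}` and `hi_i ≤ f(x)_i` on `{x_i = 1}` attains every
value `a` with `lo ≤ a ≤ hi` on the closed unit cube `Set.Icc 0 1 ⊆ (Fin d → ℝ)`.
[cite: VandenbergDon2020, Lemma 18] -/
theorem stub_vdbdCubeSurj :
    ∀ (d : ℕ) (f : (Fin d → ℝ) → (Fin d → ℝ)) (lo hi : Fin d → ℝ),
      ContinuousOn f (Set.Icc 0 1) →
      (∀ x ∈ Set.Icc (0 : Fin d → ℝ) 1, ∀ i, x i = 0 → f x i ≤ lo i) →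
      (∀ x ∈ Set.Icc (0 : Fin d → ℝ) 1, ∀ i, x i = 1 → hi i ≤ f x i) →
      ∀ a : Fin d → ℝ, lo ≤ a → a ≤ hi → ∃ x ∈ Set.Icc (0 : Fin d → ℝ) 1, f x = a :=
  fun _ _ _ _ hf hlo hhi _ hloa hahi =>
    NearLinearTwoClusterDecayVdbdCubeSurj.exists_mem_Icc_apply_eq hf hlo hhi hloa hahi

end Summit.CriticalPhenomena.PercolationContinuityZ3.Theorems
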